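import Mathlib.AlgebraicGeometry.FunctionField
import Mathlib.RingTheory.IntegralClosure.IntegrallyClosed
import Literature.AlgebraicGeometry.Resolution.SmoothStalksRegular
import Literature.AlgebraicGeometry.Resolution.RegularLocalRingsNormal
import Literature.AlgebraicGeometry.Motives.RelFrobeniusFactorisation
import HarnessLib

/-!
# Sections of an integral scheme are the rational functions regular at every point; roots of sections
# on a normal scheme (Görtz–Wedhorn I, Prop. 3.29 (3) and §6.10)

Topic `Literature/AlgebraicGeometry/Motives`, namespace `Literature.AlgebraicGeometry.Motives`.
THEOREMS ONLY, all proved; no definition, no named fact, no instance (net Literature debt **0**).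
Written for the cell `hodgecm-mathlib` (D-0151), fan B-II, E2 «height-one road» (A-p02's memo
`ROAD-E2-heightOne-S2degOne.md`): this is the JUNCTION (N) between the generic-point statement
«`f♯ b` is a `p`-th power in the function field `K(A)`» (A-p02, `AbelianVarietyHomGenericDifferential`,
Shimura 1998 §2.8 Prop. 6 (i)) and the hypothesis of the factorisation through the relative Frobenius
(`RelFrobeniusFactorisation.exists_eq_relFrobeniusOver_comp`: «`f♯ s` is a `p`-th power on every open»).

* `Scheme.exists_germToFunctionField_eq_of_forall_mem_range` — **Görtz–Wedhorn I, Prop. 3.29 (3)**: on an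
  INTEGRAL scheme `X`, `Γ(U, 𝒪_X) = ⋂_{x ∈ U} 𝒪_{X,x}` inside the function field `K(X)`: a rational function
  `c ∈ K(X)` lying in (the image of) every local ring `𝒪_{X,x}`, `x ∈ U`, is the germ of a UNIQUE section
  over `U`.  Proof: represent `c` near each `x ∈ U` by a section; two representatives agree on overlaps
  because sections of an integral scheme inject into `K(X)` (Prop. 3.29 (2), Mathlib
  `germToFunctionField_injective`); glue (sheaf axiom).
* `Scheme.exists_pow_eq_of_pow_eq_germToFunctionField` — on an integral scheme with INTEGRALLY CLOSED
  local rings (a normal scheme, Görtz–Wedhorn §6.10), if `c ∈ K(X)` satisfies `cⁿ = s` for a section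
  `s ∈ Γ(U, 𝒪_X)` (`n ≠ 0`), then `c ∈ Γ(U, 𝒪_X)`: `c` is integral over each `𝒪_{X,x}` (a root of `Tⁿ - s`),
  hence in `𝒪_{X,x}` (Mathlib `IsIntegrallyClosed.algebraMap_eq_of_integral` with
  `IsFractionRing 𝒪_{X,x} K(X)`), and Prop. 3.29 (3) applies.  Version without `Nonempty U`:
  `Scheme.exists_pow_eq_of_forall_pow_eq_germToFunctionField`.
* `existsUnique_eq_relFrobeniusOver_comp_of_forall_pow_eq_germToFunctionField` — composed with HO-sch
  (`RelFrobeniusFactorisation`): a `k`-morphism from a smooth integral `X` over a perfect `k` whose comorphism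
  lands in `q`-th powers OF THE FUNCTION FIELD factors uniquely through `F_{X/k} : X → X^{(q)}`.
* `exists_pow_eq_of_forall_pow_eq_germToFunctionField_of_smooth` — the same for a scheme SMOOTH over a
  field (its local rings are regular, [Stacks 056S] `Resolution.isRegularLocalRing_stalk_of_smooth_of_field`,
  hence integrally closed, Matsumura Thm. 19.4 `Resolution.isIntegrallyClosed_of_isRegularLocalRing`) —
  the case of an abelian variety.

## References
* [GortzWedhorn2020] U. Görtz, T. Wedhorn, *Algebraic Geometry I* (2nd ed.), Prop. 3.29 (2)(3) (p. 75):
  `Γ(U, 𝒪_X) → K(X)` injective and `Γ(U, 𝒪_X) = ⋂_{x∈U} 𝒪_{X,x}`; §6.10 (normal schemes).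
* [StacksProject] Tag 056S (smooth over a field ⇒ regular).
* [Matsumura1987] H. Matsumura, *Commutative Ring Theory*, Thm. 19.4 (regular ⇒ normal).
* [Shimura1998] G. Shimura, *Abelian Varieties with Complex Multiplication and Modular Functions*, §2.8
  Prop. 6 (i), §18.6 p. 129 (the consumer).
-/

noncomputable section

universe u

open CategoryTheory AlgebraicGeometry Opposite TopologicalSpace

namespace Literature.AlgebraicGeometry.Motives

variable {X : Scheme.{u}}

/-- On an irreducible scheme the generic point lies in every open containing a point. [folklore] -/
private theorem genericPoint_mem_of_mem [IrreducibleSpace X] {U : X.Opens} {x : X} (hx : x ∈ U) :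
    genericPoint X ∈ U :=
  (genericPoint_specializes x).mem_open U.isOpen hx

/-- **Görtz–Wedhorn I, Prop. 3.29 (3): `Γ(U, 𝒪_X) = ⋂_{x ∈ U} 𝒪_{X,x}` in `K(X)`.**  On an integral scheme, a
rational function lying in every local ring `𝒪_{X,x}`, `x ∈ U`, is the germ at the generic point of a
unique section over `U`. [cite: GortzWedhorn2020, Prop. 3.29 (3) (and (2): injectivity into `K(X)`)] -/
theorem Scheme.exists_germToFunctionField_eq_of_forall_mem_range [IsIntegral X] (U : X.Opens) [Nonempty U]
    (c : X.functionField) (hc : ∀ x ∈ U, c ∈ Set.range (algebraMap (X.presheaf.stalk x) X.functionField)) :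
    ∃! t : Γ(X, U), X.germToFunctionField U t = c := by
  classical
  -- local representatives: for `x ∈ U`, a section `t_x` on an open `x ∈ V_x ⊆ U` with germ `c` at the generic point
  have hloc : ∀ x : U, ∃ (V : X.Opens) (hxV : x.1 ∈ V) (_ : V ≤ U) (t : Γ(X, V)),
      X.presheaf.germ V (genericPoint X) (genericPoint_mem_of_mem hxV) t = c := by
    intro x
    obtain ⟨tx, htx⟩ := hc x.1 x.2
    obtain ⟨W, hxW, tW, htW⟩ := X.presheaf.exists_germ_eq tx
    refine ⟨W ⊓ U, ⟨hxW, x.2⟩, inf_le_right, X.presheaf.map (homOfLE inf_le_left).op tW, ?_⟩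
    rw [TopCat.Presheaf.germ_res_apply, ← htx, ← htW]
    haveI : Nonempty W := ⟨⟨x.1, hxW⟩⟩
    exact (AlgebraicGeometry.Scheme.algebraMap_germ_eq_germToFunctionField X hxW tW).symm
  choose V hxV hVU t ht using hloc
  -- the `V_x` cover `U`
  have hcover : U ≤ iSup V := fun y hy => Opens.mem_iSup.mpr ⟨⟨y, hy⟩, hxV ⟨y, hy⟩⟩
  -- compatibility on overlaps (`V_x ∩ V_y ∋` the generic point): both restrictions have germ `c` at the generic
  -- point, and germs of an integral scheme are injective
  have hcompat : TopCat.Presheaf.IsCompatible X.sheaf.1 V t := by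
    intro i j
    apply germ_injective_of_isIntegral X (genericPoint X)
      (show genericPoint X ∈ V i ⊓ V j from ⟨genericPoint_mem_of_mem (hxV i), genericPoint_mem_of_mem (hxV j)⟩)
    change X.presheaf.germ (V i ⊓ V j) (genericPoint X) _ (X.presheaf.map _ (t i)) =
      X.presheaf.germ (V i ⊓ V j) (genericPoint X) _ (X.presheaf.map _ (t j))
    rw [TopCat.Presheaf.germ_res_apply, TopCat.Presheaf.germ_res_apply, ht i, ht j]
  -- glue
  obtain ⟨s, hs, -⟩ := X.sheaf.existsUnique_gluing' V U (fun i => homOfLE (hVU i)) hcover t hcompat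
  refine ⟨s, ?_, fun s' hs' => ?_⟩
  · -- the germ of the glued section at the generic point is `c`: compute it through `V_{x₀}` for some `x₀ ∈ U`
    obtain ⟨x₀⟩ := ‹Nonempty U›
    have h1 : X.germToFunctionField U s =
        X.presheaf.germ (V x₀) (genericPoint X) (genericPoint_mem_of_mem (hxV x₀))
          (X.presheaf.map (homOfLE (hVU x₀)).op s) := by
      rw [TopCat.Presheaf.germ_res_apply]
    rw [h1]
    have h2 : X.presheaf.map (homOfLE (hVU x₀)).op s = t x₀ := hs x₀
    rw [h2, ht x₀]
  · -- uniqueness: sections of an integral scheme inject into `K(X)`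
    apply X.germToFunctionField_injective U
    rw [hs']
    -- and `germ s = c` as just shown
    obtain ⟨x₀⟩ := ‹Nonempty U›
    have h1 : X.germToFunctionField U s =
        X.presheaf.germ (V x₀) (genericPoint X) (genericPoint_mem_of_mem (hxV x₀))
          (X.presheaf.map (homOfLE (hVU x₀)).op s) := by
      rw [TopCat.Presheaf.germ_res_apply]
    have h2 : X.presheaf.map (homOfLE (hVU x₀)).op s = t x₀ := hs x₀
    rw [h1, h2, ht x₀]

/-- **Roots of sections on a normal integral scheme are sections.**  On an integral scheme whose local rings
are integrally closed, if a rational function `c` satisfies `cⁿ = s` (`n ≠ 0`) for a section `s` over `U`, then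
`c` is (the germ of) a section `t` over `U` with `tⁿ = s`: `c` is integral over each `𝒪_{X,x}`, hence in
`𝒪_{X,x}`, and `Γ(U, 𝒪_X) = ⋂_{x∈U} 𝒪_{X,x}`. [cite: GortzWedhorn2020, Prop. 3.29 (3) and §6.10 (normal schemes)] -/
theorem Scheme.exists_pow_eq_of_pow_eq_germToFunctionField [IsIntegral X]
    (hXn : ∀ x : X, IsIntegrallyClosed (X.presheaf.stalk x)) {n : ℕ} (hn : n ≠ 0)
    (U : X.Opens) [Nonempty U] (s : Γ(X, U)) (c : X.functionField) (hc : c ^ n = X.germToFunctionField U s) :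
    ∃ t : Γ(X, U), t ^ n = s ∧ X.germToFunctionField U t = c := by
  obtain ⟨t, ht, -⟩ := Scheme.exists_germToFunctionField_eq_of_forall_mem_range U c (fun x hx => by
    haveI := hXn x
    -- `c` is a root of the monic `Tⁿ - s_x ∈ 𝒪_{X,x}[T]`
    have hint : IsIntegral (X.presheaf.stalk x) c := by
      refine ⟨Polynomial.X ^ n - Polynomial.C (X.presheaf.germ U x hx s), Polynomial.monic_X_pow_sub_C _ hn, ?_⟩
      rw [Polynomial.eval₂_sub, Polynomial.eval₂_X_pow, Polynomial.eval₂_C,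
        AlgebraicGeometry.Scheme.algebraMap_germ_eq_germToFunctionField, hc, sub_self]
    exact IsIntegrallyClosed.algebraMap_eq_of_integral hint)
  refine ⟨t, ?_, ht⟩
  apply X.germToFunctionField_injective U
  rw [map_pow, ht, hc]

/-- The same without the hypothesis `U ≠ ∅` (over the empty open every section is a root: `Γ(∅, 𝒪_X) = 0`), with the
root in `K(X)` asked for only when `U` is non-empty. [cite: GortzWedhorn2020, Prop. 3.29 (3) and §6.10 (normal schemes)] -/
theorem Scheme.exists_pow_eq_of_forall_pow_eq_germToFunctionField [IsIntegral X]
    (hXn : ∀ x : X, IsIntegrallyClosed (X.presheaf.stalk x)) {n : ℕ} (hn : n ≠ 0)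
    (U : X.Opens) (s : Γ(X, U))
    (hc : ∀ _ : Nonempty U, ∃ c : X.functionField, c ^ n = X.germToFunctionField U s) :
    ∃ t : Γ(X, U), t ^ n = s := by
  by_cases hU : Nonempty U
  · obtain ⟨c, hc'⟩ := hc hU
    obtain ⟨t, ht, -⟩ := Scheme.exists_pow_eq_of_pow_eq_germToFunctionField hXn hn U s c hc'
    exact ⟨t, ht⟩
  · -- `U = ⊥`, so `Γ(X, U)` is the zero ring
    have hbot : U = ⊥ := by
      ext y
      simp only [Opens.coe_bot, Set.mem_empty_iff_false, iff_false]
      exact fun hy => hU ⟨⟨y, hy⟩⟩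
    subst hbot
    exact ⟨0, Subsingleton.elim _ _⟩

/-- **The case of a scheme smooth over a field** (e.g. an abelian variety): its local rings are regular
([Stacks 056S]) hence integrally closed (Matsumura Thm. 19.4), so roots in `K(X)` of sections are sections.
[cite: GortzWedhorn2020, Prop. 3.29 (3) and §6.10] [cite: StacksProject, Tag 056S] [cite: Matsumura1987, Thm. 19.4] -/
theorem exists_pow_eq_of_forall_pow_eq_germToFunctionField_of_smooth {K : Type u} [Field K]
    (f : X ⟶ Spec (CommRingCat.of K)) [Smooth f] [IsIntegral X] {n : ℕ} (hn : n ≠ 0)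
    (U : X.Opens) (s : Γ(X, U))
    (hc : ∀ _ : Nonempty U, ∃ c : X.functionField, c ^ n = X.germToFunctionField U s) :
    ∃ t : Γ(X, U), t ^ n = s :=
  Scheme.exists_pow_eq_of_forall_pow_eq_germToFunctionField
    (fun x => haveI := Resolution.isRegularLocalRing_stalk_of_smooth_of_field f x
      Resolution.isIntegrallyClosed_of_isRegularLocalRing _) hn U s hc

/-! ### The factorisation through the relative Frobenius, for a smooth source, from roots in the function field -/

/-- **Factorisation through `F_{X/k}` from `q`-th roots in the function field.**  Let `X` be an integral scheme
SMOOTH over a PERFECT field `k` (`q = pⁿ`, `p` the exponential characteristic) and `f : X → Y` a `k`-morphism such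
that for every open `U ⊆ Y` meeting `f(X)` and every section `s ∈ Γ(U, 𝒪_Y)`, the rational function `f♯ s ∈ K(X)`
is a `q`-th power IN THE FUNCTION FIELD.  Then `f = F_{X/k} ≫ g` for a unique `k`-morphism `g : X^{(q)} → Y`:
the roots are sections (`exists_pow_eq_of_forall_pow_eq_germToFunctionField_of_smooth`, normality of smooth
schemes) and `RelFrobeniusFactorisation.existsUnique_eq_relFrobeniusOver_comp` applies.  (For a homomorphism of
abelian varieties with zero tangent map the hypothesis is Shimura's «`k(λx) ⊂ k(x^p)`»,
`AbelianVariety.exists_pow_eq_stalkMap_genericPoint`.)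
[cite: Shimura1998, §2.8 Prop. 6 (i); §18.6 p. 129] [cite: GortzWedhorn2020, Prop. 3.29 (3), Remark/Definition 4.24, Exercise 15.8] -/
theorem existsUnique_eq_relFrobeniusOver_comp_of_forall_pow_eq_germToFunctionField {k : Type u} [Field k]
    (p : ℕ) [ExpChar k p] (n : ℕ) [PerfectRing k p] {X Y : SchemeOver k} [IsIntegral X.left] [Smooth X.hom]
    (f : X ⟶ Y)
    (hf : ∀ (U : Y.left.Opens) (s : Γ(Y.left, U)) (_ : Nonempty (f.left ⁻¹ᵁ U)),
      ∃ c : X.left.functionField, c ^ p ^ n = X.left.germToFunctionField (f.left ⁻¹ᵁ U) (f.left.app U s)) :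
    ∃! g : frobeniusTwistOver p n X ⟶ Y, f = relFrobeniusOver p n X ≫ g :=
  existsUnique_eq_relFrobeniusOver_comp p n f fun U s =>
    exists_pow_eq_of_forall_pow_eq_germToFunctionField_of_smooth (K := k) X.hom (expChar_pow_pos k p n).ne'
      (f.left ⁻¹ᵁ U) (f.left.app U s) (hf U s)

end Literature.AlgebraicGeometry.Motives

end
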